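import Mathlib
import Summits.PneNP.PneNP.Theses.RamseyUncertifiable
import Literature.Computability.MetaComplexity.ProofSystems

/-!
# Sketch — crux RamseyNotNP (stmt-PneNP-9814), ideator 2, round 1

First-lemma signatures for the idea cards
* `planting-map-demibit`  (density transfer; Erdős planting map = planted-clique generator;
  Rudich demi-bit form of X),
* `erdos-rule-elimination` (Jeřábek–Krajíček implicit-axiom elimination: non-simulation of
  `V + Erdős rule` by `V` ⇒ every-instance hardness of Ramsey certification for `V`).

Everything is stated over existing declarations (route decls, `encodingGraph`, `NP`,
`IsProofSystemFor`, `Simulates`, Mathlib `SimpleGraph.CliqueFree`, `Nat.clog`).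
Proofs are not required at the idea stage; the easy ones are given.
-/

open Literature.Computability.Complexity Literature.Computability.Complexity.Nondeterministic
open Literature.Computability.MetaComplexity
open Summit.PneNP.PneNP.Theses.RamseyUncertifiable

namespace Summit.PneNP.PneNP.Cruxes.RamseyNotNP.Ideator2

/-! ## Common objects -/

/-- Ramsey graphs at the Erdős threshold `k(n) = ⌈2 log₂ n⌉ = Nat.clog 2 (n^2)`, as sigma pairs
(literally the set-builder of the route decl `RamseyNotNP`). -/
def ramseySet : Set (Σ n, SimpleGraph (Fin n)) :=
  {p | p.2.CliqueFree (Nat.clog 2 (p.1 ^ 2)) ∧ p.2ᶜ.CliqueFree (Nat.clog 2 (p.1 ^ 2))}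

/-- The language RAMSEY₂ of the crux. -/
noncomputable def ramseyLang : Language Bool := encodingGraph.toLanguage ramseySet

/-- The crux, unfolded. -/
theorem ramseyNotNP_iff : RamseyNotNP ↔ ramseyLang ∉ NP := Iff.rfl

/-- Number of `n`-vertex graphs whose code lies in `L` (density numerator). -/
noncomputable def countIn (L : Language Bool) (n : ℕ) : ℕ := by
  classical
  exact (Finset.univ.filter fun G : SimpleGraph (Fin n) => encodingGraph.encode ⟨n, G⟩ ∈ L).card

/-! ## Card `planting-map-demibit` -/

/-- The Erdős planting map (= the planted-clique/coclique generator at `k = ⌈2log₂ n⌉`):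
make `S` homogeneous of colour `c` inside `H`. Its range is exactly the set of NON-Ramsey graphs
(`not_mem_ramseySet_iff_exists_plant`), and by the Erdős union bound (route support
`RamseyAbundant`) it is *stretching*: fewer inputs `(S, c, H|outside S)` than graphs. -/
def plant {n : ℕ} (S : Finset (Fin n)) (c : Bool) (H : SimpleGraph (Fin n)) : SimpleGraph (Fin n) :=
  SimpleGraph.fromRel fun u v => if u ∈ S ∧ v ∈ S then c = true else H.Adj u v

/-- Range of the planting map = complement of RAMSEY₂ (generator view of the crux:
`RAMSEY₂ = {0,1}^* ∖ rng(g_Ram)`, so `X` says `g_Ram` is not p-bounded-refutable by ANY proof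
system; cf. Krajíček, *Proof complexity* (2019) §19.4, Lemma 19.4.1). -/
theorem plant_adj {n : ℕ} (S : Finset (Fin n)) (c : Bool) (H : SimpleGraph (Fin n)) (u v : Fin n) :
    (plant S c H).Adj u v ↔ u ≠ v ∧ (if u ∈ S ∧ v ∈ S then c = true else H.Adj u v) := by
  unfold plant
  rw [SimpleGraph.fromRel_adj]
  constructor
  · rintro ⟨hne, h⟩
    refine ⟨hne, ?_⟩
    rcases h with h | h
    · exact h
    · by_cases huv : u ∈ S ∧ v ∈ S
      · rw [if_pos huv]
        rw [if_pos ⟨huv.2, huv.1⟩] at h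
        exact h
      · rw [if_neg huv]
        have hvu : ¬ (v ∈ S ∧ u ∈ S) := fun h' => huv ⟨h'.2, h'.1⟩
        rw [if_neg hvu] at h
        exact h.symm
  · rintro ⟨hne, h⟩
    exact ⟨hne, Or.inl h⟩

theorem not_mem_ramseySet_iff_exists_plant (n : ℕ) (G : SimpleGraph (Fin n)) :
    (⟨n, G⟩ : Σ n, SimpleGraph (Fin n)) ∉ ramseySet ↔
      ∃ S : Finset (Fin n), S.card = Nat.clog 2 (n ^ 2) ∧ ∃ (c : Bool) (H : SimpleGraph (Fin n)),
        plant S c H = G := by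
  simp only [ramseySet, Set.mem_setOf_eq, not_and_or, SimpleGraph.CliqueFree, not_forall,
    not_not]
  constructor
  · rintro (⟨t, ht⟩ | ⟨t, ht⟩)
    · -- `t` is a clique of `G`: plant colour `true` into `G` itself
      rw [SimpleGraph.isNClique_iff] at ht
      refine ⟨t, ht.2, true, G, ?_⟩
      ext u v
      rw [plant_adj]
      by_cases huv : u ∈ t ∧ v ∈ t
      · rw [if_pos huv]
        constructor
        · rintro ⟨hne, -⟩
          exact ht.1 huv.1 huv.2 hne
        · intro hadj
          exact ⟨hadj.ne, rfl⟩
      · rw [if_neg huv]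
        exact ⟨fun h => h.2, fun h => ⟨h.ne, h⟩⟩
    · -- `t` is a clique of `Gᶜ` (independent in `G`): plant colour `false` into `G`
      rw [SimpleGraph.isNClique_iff] at ht
      refine ⟨t, ht.2, false, G, ?_⟩
      ext u v
      rw [plant_adj]
      by_cases huv : u ∈ t ∧ v ∈ t
      · rw [if_pos huv]
        constructor
        · rintro ⟨-, h⟩
          exact absurd h Bool.false_ne_true
        · intro hadj
          have hc : Gᶜ.Adj u v := ht.1 huv.1 huv.2 hadj.ne
          rw [SimpleGraph.compl_adj] at hc
          exact absurd hadj hc.2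
      · rw [if_neg huv]
        exact ⟨fun h => h.2, fun h => ⟨h.ne, h⟩⟩
  · rintro ⟨S, hS, c, H, rfl⟩
    cases c
    · -- colour `false`: `S` is a clique of the complement
      right
      refine ⟨S, ?_⟩
      rw [SimpleGraph.isNClique_iff]
      refine ⟨?_, hS⟩
      intro u hu v hv hne
      rw [SimpleGraph.compl_adj, plant_adj]
      refine ⟨hne, ?_⟩
      rintro ⟨-, h⟩
      rw [if_pos ⟨hu, hv⟩] at h
      exact Bool.false_ne_true h
    · -- colour `true`: `S` is a clique
      left
      refine ⟨S, ?_⟩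
      rw [SimpleGraph.isNClique_iff]
      refine ⟨?_, hS⟩
      intro u hu v hv hne
      rw [plant_adj]
      refine ⟨hne, ?_⟩
      rw [if_pos ⟨hu, hv⟩]

/-- Stretching of the planting map = the Erdős count (same inequality as `RamseyAbundant`):
`#inputs = C(n,k)·2·2^{C(n,2)-C(k,2)} < 2^{C(n,2)} = #graphs` for `n ≥ 3`, `k = clog 2 (n^2)`. -/
def PlantStretching : Prop :=
  ∀ n ≥ 3, n.choose (Nat.clog 2 (n ^ 2)) * 2 * 2 ^ (n.choose 2 - (Nat.clog 2 (n ^ 2)).choose 2)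
    < 2 ^ n.choose 2

/-- Erdős density at the exact threshold: for `n ≥ 3` at least half of all `n`-vertex graphs are
Ramsey (the union bound gives non-Ramsey fraction `≤ 2·2^{k/2}/k! ≤ 1/3` for `k ≥ 4`). -/
def RamseyDense : Prop :=
  ∀ n ≥ 3, Fintype.card (SimpleGraph (Fin n)) ≤ 2 * countIn ramseyLang n

/-- **Density-½ co-nondeterministic planted-clique hypothesis** (`X_{1/2}`): every NP language
that eventually contains at least half of all `n`-vertex graph codes contains the code of a
NON-Ramsey graph (equivalently: no NP-certifiable graph property of density ≥ ½ implies
`⌈2log₂n⌉`-homogeneous-set-freeness). Weakest member of the demi-bit family that implies `X`. -/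
def DenseBreakerMeetsPlanted : Prop :=
  ∀ L ∈ NP, (∃ n₀, ∀ n ≥ n₀, Fintype.card (SimpleGraph (Fin n)) ≤ 2 * countIn L n) →
    ∃ p : Σ n, SimpleGraph (Fin n), encodingGraph.encode p ∈ L ∧ p ∉ ramseySet

/-- **Rudich demi-bit form** (uniform): the planting map is a demi-bit generator against uniform
NP tests of inverse-polynomial density infinitely often — every NP language of i.o.-density
`≥ 1/n^c` meets the planted (non-Ramsey) graphs. [Rudich 1997, Def. 7 / Conj. 5, uniform and
specialised to `g_Ram`]. -/
def PlantingIsDemiBit : Prop :=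
  ∀ L ∈ NP, ∀ c : ℕ, (∀ n₀, ∃ n ≥ n₀, Fintype.card (SimpleGraph (Fin n)) ≤ n ^ c * countIn L n) →
    ∃ p : Σ n, SimpleGraph (Fin n), encodingGraph.encode p ∈ L ∧ p ∉ ramseySet

/-- Krajíček hardness of `g_Ram` for ALL proof systems ⟺ NP-immunity of RAMSEY₂ (Krajíček 2019,
Lemma 19.4.1). Recorded as the REFUTED-IN-SPIRIT strengthening: it fails as soon as RAMSEY₂ is
"feasibly infinite" (an explicit construction), cf. `not_immune_of_explicit`. -/
def RamseyNPImmune : Prop :=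
  ∀ L ∈ NP, L ≤ ramseyLang → Set.Finite (L : Set (List Bool))

/-- An explicit (polynomial-time) construction of Ramsey graphs of all large sizes kills
NP-immunity (its image is an infinite P ⊆ NP subset). `f` maps `1^n` to the code of a Ramsey
graph on `n` vertices. -/
theorem not_immune_of_explicit (f : List Bool → List Bool) (hf : f ∈ FP)
    (hR : ∃ n₀, ∀ n ≥ n₀, ∃ G : SimpleGraph (Fin n), (⟨n, G⟩ : Σ n, SimpleGraph (Fin n)) ∈ ramseySet ∧
      f (List.replicate n true) = encodingGraph.encode ⟨n, G⟩)
    (hP : {x | ∃ n, x = f (List.replicate n true) ∧ x ∈ ramseyLang} ∈ NP) :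
    ¬ RamseyNPImmune := by
  have _hf := hf -- (p-time computability of `f` is what makes the subset a P-set; unused here)
  intro himm
  obtain ⟨n₀, hn₀⟩ := hR
  have hsub : ({x | ∃ n, x = f (List.replicate n true) ∧ x ∈ ramseyLang} : Language Bool) ≤
      ramseyLang := by
    rintro x ⟨n, -, hx⟩
    exact hx
  have hfin := himm _ hP hsub
  apply hfin.not_infinite
  have key : ∀ n, ∃ G : SimpleGraph (Fin (n + n₀)),
      (⟨n + n₀, G⟩ : Σ n, SimpleGraph (Fin n)) ∈ ramseySet ∧
        f (List.replicate (n + n₀) true) = encodingGraph.encode ⟨n + n₀, G⟩ :=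
    fun n => hn₀ (n + n₀) (Nat.le_add_left _ _)
  refine Set.infinite_of_injective_forall_mem
    (f := fun n : ℕ => f (List.replicate (n + n₀) true)) ?_ ?_
  · intro a b hab
    obtain ⟨Ga, -, ha⟩ := key a
    obtain ⟨Gb, -, hb⟩ := key b
    simp only at hab
    rw [ha, hb] at hab
    have h1 := congrArg Sigma.fst (encodingGraph.encode_injective hab)
    exact Nat.add_right_cancel h1
  · intro n
    obtain ⟨G, hG, hfG⟩ := key n
    refine ⟨n + n₀, rfl, ?_⟩
    show f (List.replicate (n + n₀) true) ∈ ramseyLang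
    rw [hfG]
    exact (Computability.Encoding.mem_toLanguage_iff _ _ _).2 hG

/-- **FIRST LEMMA (card `planting-map-demibit`)**: the density transfer `X_{1/2} → X`. -/
theorem ramseyNotNP_of_dense (hd : RamseyDense) (h : DenseBreakerMeetsPlanted) : RamseyNotNP := by
  show ramseyLang ∉ NP
  intro hNP
  obtain ⟨p, hp, hpR⟩ := h _ hNP ⟨3, hd⟩
  exact hpR ((Computability.Encoding.mem_toLanguage_iff _ _ _).1 hp)

/-- Demi-bit form ⇒ density-½ form (density ½ for all large `n` is i.o.-density `≥ 1/n`). -/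
theorem dense_of_demiBit (h : PlantingIsDemiBit) : DenseBreakerMeetsPlanted := by
  intro L hL hdense
  obtain ⟨n₀, hn₀⟩ := hdense
  refine h L hL 1 fun m₀ => ?_
  refine ⟨max (max n₀ m₀) 2, le_trans (le_max_right _ _) (le_max_left _ _), ?_⟩
  have h2 : 2 ≤ max (max n₀ m₀) 2 := le_max_right _ _
  have := hn₀ (max (max n₀ m₀) 2) (le_trans (le_max_left _ _) (le_max_left _ _))
  calc Fintype.card (SimpleGraph (Fin (max (max n₀ m₀) 2)))
      ≤ 2 * countIn L (max (max n₀ m₀) 2) := this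
    _ ≤ (max (max n₀ m₀) 2) ^ 1 * countIn L (max (max n₀ m₀) 2) := by
        rw [pow_one]; exact Nat.mul_le_mul_right _ h2

/-! ## Card `erdos-rule-elimination` -/

/-- `W` is *eliminable over `V` modulo Ramsey witnesses* (abstract form of Jeřábek's `WF`/
Krajíček 2019 Lemma 19.5.4 with the single extra axiom family `g_Ram(D̄) ≢ r̄`, "let `r̄` be a
generic Ramsey graph"): a `W`-proof `ρ` of `x` becomes a `V`-proof of `x` of length polynomial in
`|x| + |ρ| + max_m |π_m|` once, for every size `3 ≤ m ≤ |ρ|`, SOME Ramsey graph `b_m` with a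
`V`-proof `π_m` of its Ramsey-ness is supplied (substitute `b_m` for `r̄` and discharge the axiom
by `π_m`). -/
def ElimProp (V W : List Bool → List Bool → Bool) : Prop :=
  ∃ q : Polynomial ℕ, ∀ x ρ, W x ρ = true →
    ∀ (b : (m : ℕ) → SimpleGraph (Fin m)) (π : ℕ → List Bool),
      (∀ m, 3 ≤ m → m ≤ ρ.length →
        (⟨m, b m⟩ : Σ n, SimpleGraph (Fin n)) ∈ ramseySet ∧ V (encodingGraph.encode ⟨m, b m⟩) (π m) = true) →
      ∃ π', π'.length ≤ q.eval (x.length + ρ.length +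
          (Finset.range (ρ.length + 1)).sup fun m => (π m).length) ∧ V x π' = true

/-- Some Ramsey instance of every large size is EASY for `V` (negation of every-instance
hardness i.o.). -/
def SomeInstanceEasy (V : List Bool → List Bool → Bool) : Prop :=
  ∃ c m₀ : ℕ, ∀ m ≥ m₀, ∃ G : SimpleGraph (Fin m), (⟨m, G⟩ : Σ n, SimpleGraph (Fin n)) ∈ ramseySet ∧
    ∃ π, π.length ≤ m ^ c ∧ V (encodingGraph.encode ⟨m, G⟩) π = true

/-- **FIRST LEMMA (card `erdos-rule-elimination`)**: elimination + one easy Ramsey instance per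
size ⇒ `V` simulates `W`. Contrapositive (the lever): if `V` does NOT simulate `V + Erdős rule`,
then for every `c`, for infinitely many `m`, EVERY Ramsey graph on `m` vertices needs `V`-proofs
longer than `m^c` — LPRT-shape every-instance hardness, obtained from a uniform separation. -/
theorem simulates_of_elim_of_someInstanceEasy {V W : List Bool → List Bool → Bool}
    (hV : IsProofSystemFor V ramseyLang) (hab : RamseyAbundant)
    (hE : ElimProp V W) (he : SomeInstanceEasy V) : Simulates V W := by
  sorry

/-- Cook–Reckhow form of the crux for THIS language (from the tree fact
`hasPolyBoundedProofSystem_iff_mem_NP`): `X` iff no proof system for RAMSEY₂ is p-bounded. -/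
theorem ramseyNotNP_iff_not_hasPolyBounded
    (hCR : @hasPolyBoundedProofSystem_iff_mem_NP ramseyLang) :
    RamseyNotNP ↔ ¬ HasPolyBoundedProofSystem ramseyLang := by
  rw [ramseyNotNP_iff]
  exact not_congr hCR.symm

end Summit.PneNP.PneNP.Cruxes.RamseyNotNP.Ideator2
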